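/-
Copyright (c) 2026 the pub-hodgecm-mathlib formalisation cell (harness21).  Prover seat hodgecm-mathlib-LH4-p04 (g2), req620 Track A «(D-RAM) FOUR-FRAME» squad
(MS ROAD A, STAGE B brick B3₂ «TYPE-2 STRATA TABLE» — part 8: THE TEN GENUINE TYPE-2 STRATA with their axis vectors, and the AXIS-KEYED INVERSIONS the socket assemblers consume).  2026-09-04.
-/
import Summits.HodgeConjecture.HodgeConjecture.Theorems.F0P3cDyRamDiagonalStrataShapesTypeTwo   -- ★ p856358 (this seat): brings ★ 6b `typeTwo_sieve`, the eleven ★ X-kills, ★ axis lemmas, ★ `hasAxis_unique`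
import HarnessLib

/-!
# Crux `H413`, line LH4 «(D-RAM) FOUR-FRAME» road — unit U3_Laws (iii), MS ROAD A, STAGE B brick B3₂ (part 8): THE TEN GENUINE TYPE-2 STRATA IN HNF LETTERS, WITH AXES, AND THEIR
# INVERSION BY AXIS VECTOR (the «stratumTwo(a) ⊆ explicit frame set» input of the G-, H- and T-socket₂ assemblies)

Cell `hodgecm-mathlib` (D-0151), FLOOR 0, crux item H413 = `stmt-HodgeConjecture-24833`, route of record `HCCMUnconditional`; squad F0∕P3c∕LH4 (req618∕req620); registered stub served:
`F0P3cDyRamFourFrameU3.stub_U3_stableModelSum` (MS).  THEOREMS ONLY (no `def`, no instance, no notation, no `sorry`, default heartbeats); lane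
`--supports stmt-HodgeConjecture-24833 --as helper` (count-neutral).  Asked for by name by F0P3-p01 (g31) 2026-09-04T01:09:49Z (G-socket₂ assembly F1₂).

THE MATHEMATICS (LH4-p10 MEMO v2.1 §T2.1; this seat's census `CENSUS-B3type2.v1`).  For the HNF lattice `M = latt V`, `V = (1 0 0; x ϖ^b 0; y z ϖ^c)`, `x y z ∈ 𝒪`, NORMALISED and a
type-2 vertex of some `σ`-fixed non-degenerate diagonal form, ★ part 6b `typeTwo_sieve` leaves 21 letter families; the eleven residual ones are empty (★ X1 p856168, ★ X2∕X8∕X10∕X11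
p856333, ★ X3∕X4∕X6∕X7 p856158, ★ X5∕X9 p856284), so TEN GENUINE families remain, and on each the axis vector `a(M)` (`M ∩ K·eᵢ = 𝔭^{aᵢ} eᵢ`) is explicit (★ p856334, ★ part 4):
T₃ `c = 0`, `b` odd: `(b,b,0)` · T₁ `b = 0`, `|z| = 1`, `|xz − y| ≤ |ϖ^c|`: `(0,c,c)` · foot G₁(1, c−1) `b = 0`, `|z| = 1`, `|xz − y| = |ϖ^(c−1)|`, `c ≥ 3`: `(1,c,c)` · H(1) `b = 0`, `c = 1`,
`|z| = |xz − y| = 1`: `(1,1,1)` · T₂ `b = 0`, `|z| ≤ |ϖ^c|`, `|y| = 1`: `(c,0,c)` · foot G₂(1, c−1) `b = 0`, `|z| = |ϖ^(c−1)|`, `|y| = 1`, `c ≥ 3`: `(c,1,c)` · G₁ `b ≥ 1`, `c` odd `≥ 2b+3`,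
`|z| = |ϖ^b|`, `|y| = 1`, `|xz − yϖ^b| = |ϖ^(c−b−1)|`: `(2b+1, c, c)` · H `b ≥ 1`, `c = 2b+1`, `|z| = |ϖ^b|`, `|y| = 1`, `|xz − yϖ^b| = |ϖ^b|`: `(c,c,c)` · G₂ `b ≥ 1`, `c` odd `≥ 2b+3`,
`|z| = |ϖ^(c−b−1)|`, `|y| = 1`: `(c, 2b+1, c)` · G₃ `m < b`, `c = 2m+1`, `b + m` even, `|z| = |ϖ^m|`, (`m ≥ 1 → |y| = 1`): `(b+m+1, b+m+1, c)` (all `c` odd).  Since the axis vector is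
unique (★ `hasAxis_unique`), PRESCRIBING the axis inverts the table: axis `(2ρ+1, 2ρ+1+s, 2ρ+1+s)` with `s ≥ 1` forces the glued letters `b = ρ`, `c = 2ρ+1+s`, `s` even `≥ 2`,
`|z| = |ϖ^b|`, `|xz − yϖ^b| = |ϖ^(c−b−1)|` (`|y| = |x| = 1` once `b ≥ 1`) — the foot (`ρ = 0`) and the tube (`ρ ≥ 1`) in one text; similarly for the two other glued orientations, for
the core-hanging axis `(2ρ+1)³`, and for the three odd split axes.

WHAT IS PROVED.  `typeTwo_genuine` (the ten genuine families, letters of ★ `typeTwo_sieve` VERBATIM, each with its `HasAxis` clause); `letters_of_hasAxis_G1 ∕ _G2 ∕ _G3 ∕ _H ∕ _T1 ∕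
_T2 ∕ _T3` (axis ⟹ letters; same binders as ★ `typeTwo_sieve`, then the axis hypothesis).
HONEST LABEL.  Count-neutral (`--supports`); nothing printed is asserted; (MS) stays a PROVER TARGET (empirical census law — MEMO v2∕v2.1 is its paper proof, oracle-checked);
`HC_CM` is proved only modulo the 7 printed citations (2 remaining named inputs: hLiu418 = `stmt-HodgeConjecture-24832`, h413 = `stmt-HodgeConjecture-24833`) until rung 0 closes.

## References
* [Jacobowitz1962] R. Jacobowitz, *Hermitian forms over local fields*, Amer. J. Math. 84 (1962), §7–§8 (`𝔭`-modular lattices).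
* [Kottwitz1986BaseChangeUnits] R. E. Kottwitz, *Base change for unit elements of Hecke algebras*, Compositio Math. 60 (1986), §1 pp. 240–241 (fixed lattices counted by position).
* [Serre1980Trees] J.-P. Serre, *Trees*, Springer (1980), Ch. II §1.1 (Hermite normal forms, coordinate axes).
* [BruhatTits1972] F. Bruhat, J. Tits, *Groupes réductifs sur un corps local I*, Publ. Math. IHÉS 41 (1972), §10 (apartments: distance to the splitting sub-buildings).
-/

set_option autoImplicit false

noncomputable section

namespace Summit.HodgeConjecture.HodgeConjecture.Cruxes.H413.F0P3cDyRamDiagonalTypeTwoGenuineCases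

open Matrix
open Literature.NumberTheory.Automorphic Literature.NumberTheory.Automorphic.HermitianLattice
open Literature.NumberTheory.Automorphic.UnitaryLatticeTree Literature.NumberTheory.Automorphic.UnitaryThreeFourFrame
open Summit.HodgeConjecture.HodgeConjecture.Cruxes.H413.F0P3cDyRamDiagonalTorusDefs
open Summit.HodgeConjecture.HodgeConjecture.Cruxes.H413.F0P3cDyRamDiagonalStrataDefs
open Summit.HodgeConjecture.HodgeConjecture.Cruxes.H413.F0P3cDyRamDiagonalStableLatticeHNF
open Summit.HodgeConjecture.HodgeConjecture.Cruxes.H413.F0P3cDyRamDiagonalStableLatticeHNFExists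
open Summit.HodgeConjecture.HodgeConjecture.Cruxes.H413.F0P3cDyRamDiagonalStrataAxis
open Summit.HodgeConjecture.HodgeConjecture.Cruxes.H413.F0P3cDyRamDiagonalStrataShapes
open Summit.HodgeConjecture.HodgeConjecture.Cruxes.H413.F0P3cDyRamDiagonalHNFAxisOfExponents
open Summit.HodgeConjecture.HodgeConjecture.Cruxes.H413.F0P3cDyRamDiagonalDualisableStrataTypeTwoSieve
open Summit.HodgeConjecture.HodgeConjecture.Cruxes.H413.F0P3cDyRamDiagonalTypeTwoExclX1
open Summit.HodgeConjecture.HodgeConjecture.Cruxes.H413.F0P3cDyRamDiagonalTypeTwoExclColumnOne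
open Summit.HodgeConjecture.HodgeConjecture.Cruxes.H413.F0P3cDyRamDiagonalTypeTwoExclX3467
open Summit.HodgeConjecture.HodgeConjecture.Cruxes.H413.F0P3cDyRamDiagonalTypeTwoExclX59
open scoped Valued WithZero Matrix MatrixGroups
open Summit.HodgeConjecture.HodgeConjecture.Cruxes.H413.F0P3cDyRamDiagonalTypeTwoExclColumnOne
open Summit.HodgeConjecture.HodgeConjecture.Cruxes.H413.F0P3cDyRamDiagonalStrataShapesTypeTwo

variable {K : Type} [Field K] [Valued K ℤᵐ⁰]

/-- Transport of `HasAxis` along an equality of axis vectors. [cite: Serre1980Trees, II §1.1] -/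
private theorem hasAxis_congr {ϖ : K} {M : Submodule 𝒪[K] (Fin 3 → K)} {a a' : Fin 3 → ℕ} (h : HasAxis ϖ M a) (e : a = a') : HasAxis ϖ M a' := e ▸ h

/-- Componentwise reading of an equality of `3`-vectors. [cite: Serre1980Trees, II §1.1] -/
private theorem vec3_eq {u₀ u₁ u₂ v₀ v₁ v₂ : ℕ} (h : (![u₀, u₁, u₂] : Fin 3 → ℕ) = ![v₀, v₁, v₂]) : u₀ = v₀ ∧ u₁ = v₁ ∧ u₂ = v₂ := by
  refine ⟨?_, ?_, ?_⟩
  · simpa using congrFun h 0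
  · simpa using congrFun h 1
  · simpa using congrFun h 2

/-- In a NORMALISED HNF lattice with `b ≥ 1` the entry `x` is a unit (★ `normalised_latt_hnf_iff`). [cite: Serre1980Trees, II §1.1] [cite: Kottwitz1986BaseChangeUnits, §1 pp. 240–241] -/
theorem v_x_eq_one_of_one_le {ϖ : K} (hϖ : Valued.v ϖ = WithZero.exp (-1 : ℤ)) {b c : ℕ} {x y z : K}
    (hx : Valued.v x ≤ 1) (hy : Valued.v y ≤ 1) (hz : Valued.v z ≤ 1) (hn : IsNormalisedLattice (latt (Matrix.of ![![1, 0, 0], ![x, ϖ ^ b, 0], ![y, z, ϖ ^ c]]))) (hb : 1 ≤ b) :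
    Valued.v x = 1 := by
  have hq : ∀ n : ℕ, Valued.v (ϖ ^ n) = WithZero.exp (-(n : ℤ)) := fun n => by
    rw [map_pow, hϖ, ← WithZero.exp_nsmul]; congr 1; simp
  have hq1 : ∀ n : ℕ, Valued.v (ϖ ^ n) ≤ 1 := fun n => by rw [hq, ← WithZero.exp_zero, WithZero.exp_le_exp]; omega
  have hN := (normalised_latt_hnf_iff hx hy hz (hq1 b) (hq1 c)).1 hn
  exact hN.1.resolve_left fun h => by rw [hq, ← WithZero.exp_zero, WithZero.exp_inj] at h; omega

/-- **B3₂ · THE TEN GENUINE TYPE-2 STRATA.**  For the normalised HNF lattice `latt (1 0 0; x ϖ^b 0; y z ϖ^c)` that is a type-2 vertex of some `σ`-fixed non-degenerate diagonal form, the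
letters `(b, c, |z|, |y|, |xz − yϖ^b|)` lie in one of the TEN genuine families of ★ `typeTwo_sieve` (its first ten disjuncts VERBATIM — the eleven residual families are ★-empty), and in
each family the axis vector is the displayed one: T₃ `(b,b,0)`, T₁ `(0,c,c)`, foot `(1,c,c)`, H(1) `(1,1,1)`, T₂ `(c,0,c)`, foot `(c,1,c)`, G₁ `(2b+1,c,c)`, H `(c,c,c)`, G₂ `(c,2b+1,c)`,
G₃ `(b+m+1, b+m+1, c)`. [cite: Jacobowitz1962, §7–§8] [cite: Kottwitz1986BaseChangeUnits, §1 pp. 240–241] [cite: Serre1980Trees, II §1.1] [cite: BruhatTits1972, §10] -/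
theorem typeTwo_genuine {σ : K →+* K} (hvσ : ∀ a, Valued.v (σ a) = Valued.v a)
    (hfix : ∀ t : K, σ t = t → t ≠ 0 → ∃ n : ℤ, Valued.v t = WithZero.exp (2 * n))
    {ϖ : K} (hϖ : Valued.v ϖ = WithZero.exp (-1 : ℤ)) (b c : ℕ) {x y z : K}
    (hx : Valued.v x ≤ 1) (hy : Valued.v y ≤ 1) (hz : Valued.v z ≤ 1)
    (hn : IsNormalisedLattice (latt (Matrix.of ![![1, 0, 0], ![x, ϖ ^ b, 0], ![y, z, ϖ ^ c]])))
    (hpol : ∃ D : Fin 3 → K, (∀ i, σ (D i) = D i ∧ D i ≠ 0) ∧ IsVertexLattice σ ϖ (Matrix.diagonal D) 2 (latt (Matrix.of ![![1, 0, 0], ![x, ϖ ^ b, 0], ![y, z, ϖ ^ c]]))) :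
    (c = 0 ∧ b % 2 = 1 ∧ HasAxis ϖ (latt (Matrix.of ![![1, 0, 0], ![x, ϖ ^ b, 0], ![y, z, ϖ ^ c]])) ![b, b, 0]) ∨
    (b = 0 ∧ c % 2 = 1 ∧ Valued.v z = 1 ∧ Valued.v (x * z - y * ϖ ^ b) ≤ Valued.v (ϖ ^ c) ∧ HasAxis ϖ (latt (Matrix.of ![![1, 0, 0], ![x, ϖ ^ b, 0], ![y, z, ϖ ^ c]])) ![0, c, c]) ∨
    (b = 0 ∧ c % 2 = 1 ∧ 3 ≤ c ∧ Valued.v z = 1 ∧ Valued.v (x * z - y * ϖ ^ b) = Valued.v (ϖ ^ (c - 1)) ∧ HasAxis ϖ (latt (Matrix.of ![![1, 0, 0], ![x, ϖ ^ b, 0], ![y, z, ϖ ^ c]])) ![1, c, c]) ∨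
    (b = 0 ∧ c = 1 ∧ Valued.v z = 1 ∧ Valued.v (x * z - y * ϖ ^ b) = 1 ∧ HasAxis ϖ (latt (Matrix.of ![![1, 0, 0], ![x, ϖ ^ b, 0], ![y, z, ϖ ^ c]])) ![1, 1, 1]) ∨
    (b = 0 ∧ c % 2 = 1 ∧ Valued.v z ≤ Valued.v (ϖ ^ c) ∧ Valued.v y = 1 ∧ HasAxis ϖ (latt (Matrix.of ![![1, 0, 0], ![x, ϖ ^ b, 0], ![y, z, ϖ ^ c]])) ![c, 0, c]) ∨
    (b = 0 ∧ c % 2 = 1 ∧ 3 ≤ c ∧ Valued.v z = Valued.v (ϖ ^ (c - 1)) ∧ Valued.v y = 1 ∧ HasAxis ϖ (latt (Matrix.of ![![1, 0, 0], ![x, ϖ ^ b, 0], ![y, z, ϖ ^ c]])) ![c, 1, c]) ∨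
    (1 ≤ b ∧ c % 2 = 1 ∧ 2 * b + 3 ≤ c ∧ Valued.v z = Valued.v (ϖ ^ b) ∧ Valued.v y = 1 ∧ Valued.v (x * z - y * ϖ ^ b) = Valued.v (ϖ ^ (c - b - 1)) ∧
      HasAxis ϖ (latt (Matrix.of ![![1, 0, 0], ![x, ϖ ^ b, 0], ![y, z, ϖ ^ c]])) ![2 * b + 1, c, c]) ∨
    (1 ≤ b ∧ c = 2 * b + 1 ∧ Valued.v z = Valued.v (ϖ ^ b) ∧ Valued.v y = 1 ∧ Valued.v (x * z - y * ϖ ^ b) = Valued.v (ϖ ^ b) ∧ HasAxis ϖ (latt (Matrix.of ![![1, 0, 0], ![x, ϖ ^ b, 0], ![y, z, ϖ ^ c]])) ![c, c, c]) ∨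
    (1 ≤ b ∧ c % 2 = 1 ∧ 2 * b + 3 ≤ c ∧ Valued.v z = Valued.v (ϖ ^ (c - b - 1)) ∧ Valued.v y = 1 ∧ HasAxis ϖ (latt (Matrix.of ![![1, 0, 0], ![x, ϖ ^ b, 0], ![y, z, ϖ ^ c]])) ![c, 2 * b + 1, c]) ∨
    (∃ m : ℕ, m < b ∧ c = 2 * m + 1 ∧ (b + m) % 2 = 0 ∧ Valued.v z = Valued.v (ϖ ^ m) ∧ (1 ≤ m → Valued.v y = 1) ∧ HasAxis ϖ (latt (Matrix.of ![![1, 0, 0], ![x, ϖ ^ b, 0], ![y, z, ϖ ^ c]])) ![b + m + 1, b + m + 1, c]) := by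
  have hq : ∀ n : ℕ, Valued.v (ϖ ^ n) = WithZero.exp (-(n : ℤ)) := fun n => by
    rw [map_pow, hϖ, ← WithZero.exp_nsmul]; congr 1; simp
  have hxb : 1 ≤ b → Valued.v x = 1 := v_x_eq_one_of_one_le hϖ hx hy hz hn
  rcases typeTwo_sieve hvσ hfix hϖ b c hx hy hz hn hpol with
    ⟨hc, hb⟩ | ⟨hb, hc, hz1, hw⟩ | ⟨hb, hc, hc3, hz1, hw⟩ | ⟨hb, hc, hz1, hw⟩ | ⟨hb, hc, hzc, hy1⟩ | ⟨hb, hc, hc3, hzm, hy1⟩ |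
    ⟨hb1, hc, hcb, hzm, hy1, hw⟩ | ⟨hb1, hc, hzm, hy1, hw⟩ | ⟨hb1, hc, hcb, hzm, hy1⟩ | ⟨m, hmb, hc, hp, hzm, hy1⟩ |
    hX | hX | hX | hX | hX | hX | hX | hX | hX | hX | hX
  · -- T₃
    have hx1 := hxb (by omega)
    subst c
    exact Or.inl ⟨rfl, hb, hasAxis_latt_hnf_T3 hϖ b hx1 hy hz⟩
  · -- T₁
    subst b
    have hw' : Valued.v (y - x * z) ≤ Valued.v (ϖ ^ c) := by rw [Valuation.map_sub_swap]; simpa using hw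
    exact Or.inr <| Or.inl ⟨rfl, hc, hz1, hw, hasAxis_latt_hnf_T1 hϖ c hx hz1 hw'⟩
  · -- foot G₁(1, c−1)
    subst b
    have hz0 : Valued.v z = Valued.v (ϖ ^ 0) := by rw [pow_zero, map_one]; exact hz1
    have hAx := hasAxis_latt_hnf_of_exponents_zero hϖ c hx hz0 hw
    exact Or.inr <| Or.inr <| Or.inl ⟨rfl, hc, hc3, hz1, hw, hasAxis_congr hAx (by ext i; fin_cases i <;> simp; omega)⟩
  · -- H(1)
    subst b; subst c
    have hz0 : Valued.v z = Valued.v (ϖ ^ 0) := by rw [pow_zero, map_one]; exact hz1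
    have hw0 : Valued.v (x * z - y * ϖ ^ 0) = Valued.v (ϖ ^ 0) := by rw [hw, pow_zero, map_one]
    have hAx := hasAxis_latt_hnf_of_exponents_zero hϖ 1 hx hz0 hw0
    exact Or.inr <| Or.inr <| Or.inr <| Or.inl ⟨rfl, rfl, hz1, hw, hasAxis_congr hAx (by ext i; fin_cases i <;> simp)⟩
  · -- T₂
    subst b
    exact Or.inr <| Or.inr <| Or.inr <| Or.inr <| Or.inl ⟨rfl, hc, hzc, hy1, hasAxis_latt_hnf_T2 hϖ (by omega) hx hzc hy1⟩
  · -- foot G₂(1, c−1)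
    subst b
    have hw0 : Valued.v (x * z - y * ϖ ^ 0) = Valued.v (ϖ ^ 0) := by
      rw [pow_zero, mul_one, Valuation.map_sub_eq_of_lt_right _ ?_, hy1, map_one]
      rw [hy1, map_mul, hzm, hq]
      calc Valued.v x * WithZero.exp (-((c - 1 : ℕ) : ℤ)) ≤ 1 * WithZero.exp (-((c - 1 : ℕ) : ℤ)) := mul_le_mul' hx le_rfl
        _ < 1 := by rw [one_mul, ← WithZero.exp_zero, WithZero.exp_lt_exp]; omega
    have hAx := hasAxis_latt_hnf_of_exponents_zero hϖ c hx hzm hw0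
    exact Or.inr <| Or.inr <| Or.inr <| Or.inr <| Or.inr <| Or.inl ⟨rfl, hc, hc3, hzm, hy1, hasAxis_congr hAx (by ext i; fin_cases i <;> simp; omega)⟩
  · -- G₁
    have hAx := hasAxis_latt_hnf_of_exponents hϖ b c (hxb hb1) hzm hw
    exact Or.inr <| Or.inr <| Or.inr <| Or.inr <| Or.inr <| Or.inr <| Or.inl
      ⟨hb1, hc, hcb, hzm, hy1, hw, hasAxis_congr hAx (by ext i; fin_cases i <;> simp <;> omega)⟩
  · -- H
    have hAx := hasAxis_latt_hnf_of_exponents hϖ b c (hxb hb1) hzm hw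
    exact Or.inr <| Or.inr <| Or.inr <| Or.inr <| Or.inr <| Or.inr <| Or.inr <| Or.inl
      ⟨hb1, hc, hzm, hy1, hw, hasAxis_congr hAx (by ext i; fin_cases i <;> simp <;> omega)⟩
  · -- G₂ (`w = b`)
    have hx1 := hxb hb1
    have hw : Valued.v (x * z - y * ϖ ^ b) = Valued.v (ϖ ^ b) := by
      rw [Valuation.map_sub_eq_of_lt_right _ ?_, map_mul, hy1, one_mul]
      rw [map_mul, hx1, one_mul, hzm, hq, map_mul, hy1, one_mul, hq, WithZero.exp_lt_exp]; omega
    have hAx := hasAxis_latt_hnf_of_exponents hϖ b c hx1 hzm hw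
    exact Or.inr <| Or.inr <| Or.inr <| Or.inr <| Or.inr <| Or.inr <| Or.inr <| Or.inr <| Or.inl
      ⟨hb1, hc, hcb, hzm, hy1, hasAxis_congr hAx (by ext i; fin_cases i <;> simp <;> omega)⟩
  · -- G₃ (`w = m`)
    have hx1 := hxb (by omega)
    have hw : Valued.v (x * z - y * ϖ ^ b) = Valued.v (ϖ ^ m) := by
      rw [Valuation.map_sub_eq_of_lt_left _ ?_, map_mul, hx1, one_mul, hzm]
      rw [map_mul, map_mul, hx1, one_mul, hzm, hq, hq]
      calc Valued.v y * WithZero.exp (-(b : ℤ)) ≤ 1 * WithZero.exp (-(b : ℤ)) := mul_le_mul' hy le_rfl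
        _ < WithZero.exp (-(m : ℤ)) := by rw [one_mul, WithZero.exp_lt_exp]; omega
    have hAx := hasAxis_latt_hnf_of_exponents hϖ b c hx1 hzm hw
    exact Or.inr <| Or.inr <| Or.inr <| Or.inr <| Or.inr <| Or.inr <| Or.inr <| Or.inr <| Or.inr
      ⟨m, hmb, hc, hp, hzm, hy1, hasAxis_congr hAx (by ext i; fin_cases i <;> simp <;> omega)⟩
  -- the eleven residual families are not type-2 polarisable
  · obtain ⟨hb2, hbe, hc, hzc, hy1, hwc⟩ := hX
    exact (not_typeTwoPolarisable_X1 hvσ hfix hϖ hx hy hz hn hb2 hbe hc hzc hy1 hwc hpol).elim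
  · obtain ⟨hb, hce, hcb, hzc, -, hw⟩ := hX
    exact (not_typeTwoPolarisable_X2 hvσ hfix hϖ hx hy hz hn hb hce hcb hzc hw hpol).elim
  · exact (typeTwo_exclX3 hvσ hfix hϖ b c hx hy hz hn hpol hX).elim
  · exact (typeTwo_exclX4 hvσ hfix hϖ b c hx hy hz hn hpol hX).elim
  · exact (typeTwo_exclX5 hvσ hfix hϖ b c hx hy hz hn hpol hX).elim
  · exact (typeTwo_exclX6 hvσ hfix hϖ b c hx hy hz hn hpol hX).elim
  · exact (typeTwo_exclX7 hvσ hfix hϖ b c hx hy hz hn hpol hX).elim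
  · obtain ⟨m, hm3, hmb, hc, hp, hzm, hy1⟩ := hX
    exact (not_typeTwoPolarisable_X8 hvσ hfix hϖ hx hy hz hn hm3 hmb hc hp hzm hy1 hpol).elim
  · exact (typeTwo_exclX9 hvσ hfix hϖ b c hx hy hz hn hpol hX).elim
  · obtain ⟨hb1, hce, hbc, hzb, hy1, h⟩ := hX
    rcases h with ⟨hb, hwc⟩ | ⟨hb2, hcb, hw⟩
    · exact (not_typeTwoPolarisable_X10a_X11a hvσ hfix hϖ hx hy hz hn (Or.inl hb) hce (by omega) hzb hwc hpol).elim
    · exact (not_typeTwoPolarisable_X10b_X11b hvσ hfix hϖ hx hy hz hn hce hzb hy1 (k := 1) (Or.inl rfl) (by omega) (by omega) hw hpol).elim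
  · obtain ⟨hb2, hce, hbc, hzb, hy1, h⟩ := hX
    rcases h with ⟨hb, hwc⟩ | ⟨hb3, hcb, hw⟩
    · exact (not_typeTwoPolarisable_X10a_X11a hvσ hfix hϖ hx hy hz hn (Or.inr hb) hce (by omega) hzb hwc hpol).elim
    · exact (not_typeTwoPolarisable_X10b_X11b hvσ hfix hϖ hx hy hz hn hce hzb hy1 (k := 2) (Or.inr rfl) (by omega) (by omega) hw hpol).elim

/-- **GLUED AXIS, ORIENTATION G₁: `a = (2ρ+1, 2ρ+1+s, 2ρ+1+s)`, `s ≥ 1` ⟹ THE GLUED LETTERS** — `b = ρ`, `c = 2ρ+1+s`, `s` even `≥ 2`, `|z| = |ϖ^b|`, `|xz − yϖ^b| = |ϖ^(c−b−1)|`,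
and `|y| = |x| = 1` once `b ≥ 1` (the foot `ρ = 0` and the tube `ρ ≥ 1` in one text; F0P3-p01 (g31)'s F1₂ «stratumTwo ⊆ glued frame set»).
[cite: Kottwitz1986BaseChangeUnits, §1 pp. 240–241] [cite: Serre1980Trees, II §1.1] [cite: BruhatTits1972, §10] -/
theorem letters_of_hasAxis_G1 {σ : K →+* K} (hvσ : ∀ a, Valued.v (σ a) = Valued.v a)
    (hfix : ∀ t : K, σ t = t → t ≠ 0 → ∃ n : ℤ, Valued.v t = WithZero.exp (2 * n))
    {ϖ : K} (hϖ : Valued.v ϖ = WithZero.exp (-1 : ℤ)) (b c : ℕ) {x y z : K}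
    (hx : Valued.v x ≤ 1) (hy : Valued.v y ≤ 1) (hz : Valued.v z ≤ 1)
    (hn : IsNormalisedLattice (latt (Matrix.of ![![1, 0, 0], ![x, ϖ ^ b, 0], ![y, z, ϖ ^ c]])))
    (hpol : ∃ D : Fin 3 → K, (∀ i, σ (D i) = D i ∧ D i ≠ 0) ∧ IsVertexLattice σ ϖ (Matrix.diagonal D) 2 (latt (Matrix.of ![![1, 0, 0], ![x, ϖ ^ b, 0], ![y, z, ϖ ^ c]])))
    {ρ s : ℕ} (hs : 1 ≤ s) (ha : HasAxis ϖ (latt (Matrix.of ![![1, 0, 0], ![x, ϖ ^ b, 0], ![y, z, ϖ ^ c]])) ![2 * ρ + 1, 2 * ρ + 1 + s, 2 * ρ + 1 + s]) :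
    b = ρ ∧ c = 2 * ρ + 1 + s ∧ s % 2 = 0 ∧ 2 ≤ s ∧ Valued.v z = Valued.v (ϖ ^ b) ∧ Valued.v (x * z - y * ϖ ^ b) = Valued.v (ϖ ^ (c - b - 1)) ∧
      (1 ≤ b → Valued.v y = 1) ∧ (1 ≤ b → Valued.v x = 1) := by
  have hxb : 1 ≤ b → Valued.v x = 1 := v_x_eq_one_of_one_le hϖ hx hy hz hn
  rcases typeTwo_genuine hvσ hfix hϖ b c hx hy hz hn hpol with
    ⟨hc, hb, hAx⟩ | ⟨hb, hc, hz1, hw, hAx⟩ | ⟨hb, hc, hc3, hz1, hw, hAx⟩ | ⟨hb, hc, hz1, hw, hAx⟩ | ⟨hb, hc, hzc, hy1, hAx⟩ |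
    ⟨hb, hc, hc3, hzm, hy1, hAx⟩ | ⟨hb1, hc, hcb, hzm, hy1, hw, hAx⟩ | ⟨hb1, hc, hzm, hy1, hw, hAx⟩ | ⟨hb1, hc, hcb, hzm, hy1, hAx⟩ |
    ⟨m, hmb, hc, hp, hzm, hy1, hAx⟩ <;>
  obtain ⟨e0, e1, e2⟩ := vec3_eq (hasAxis_unique hϖ ha hAx)
  · omega
  · omega
  · subst b
    refine ⟨by omega, by omega, by omega, by omega, by rw [pow_zero, map_one]; exact hz1, ?_, fun h => absurd h (by omega), hxb⟩
    rw [show c - 0 - 1 = c - 1 from by omega]; exact hw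
  · omega
  · omega
  · omega
  · exact ⟨by omega, by omega, by omega, by omega, hzm, hw, fun _ => hy1, hxb⟩
  · omega
  · omega
  · omega

/-- **GLUED AXIS, ORIENTATION G₂: `a = (2ρ+1+s, 2ρ+1, 2ρ+1+s)`, `s ≥ 1` ⟹** `b = ρ`, `c = 2ρ+1+s`, `s` even `≥ 2`, `|z| = |ϖ^(c−b−1)|`, `|y| = 1` (and `|x| = 1` once `b ≥ 1`).
[cite: Kottwitz1986BaseChangeUnits, §1 pp. 240–241] [cite: Serre1980Trees, II §1.1] [cite: BruhatTits1972, §10] -/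
theorem letters_of_hasAxis_G2 {σ : K →+* K} (hvσ : ∀ a, Valued.v (σ a) = Valued.v a)
    (hfix : ∀ t : K, σ t = t → t ≠ 0 → ∃ n : ℤ, Valued.v t = WithZero.exp (2 * n))
    {ϖ : K} (hϖ : Valued.v ϖ = WithZero.exp (-1 : ℤ)) (b c : ℕ) {x y z : K}
    (hx : Valued.v x ≤ 1) (hy : Valued.v y ≤ 1) (hz : Valued.v z ≤ 1)
    (hn : IsNormalisedLattice (latt (Matrix.of ![![1, 0, 0], ![x, ϖ ^ b, 0], ![y, z, ϖ ^ c]])))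
    (hpol : ∃ D : Fin 3 → K, (∀ i, σ (D i) = D i ∧ D i ≠ 0) ∧ IsVertexLattice σ ϖ (Matrix.diagonal D) 2 (latt (Matrix.of ![![1, 0, 0], ![x, ϖ ^ b, 0], ![y, z, ϖ ^ c]])))
    {ρ s : ℕ} (hs : 1 ≤ s) (ha : HasAxis ϖ (latt (Matrix.of ![![1, 0, 0], ![x, ϖ ^ b, 0], ![y, z, ϖ ^ c]])) ![2 * ρ + 1 + s, 2 * ρ + 1, 2 * ρ + 1 + s]) :
    b = ρ ∧ c = 2 * ρ + 1 + s ∧ s % 2 = 0 ∧ 2 ≤ s ∧ Valued.v z = Valued.v (ϖ ^ (c - b - 1)) ∧ Valued.v y = 1 ∧ (1 ≤ b → Valued.v x = 1) := by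
  have hxb : 1 ≤ b → Valued.v x = 1 := v_x_eq_one_of_one_le hϖ hx hy hz hn
  rcases typeTwo_genuine hvσ hfix hϖ b c hx hy hz hn hpol with
    ⟨hc, hb, hAx⟩ | ⟨hb, hc, hz1, hw, hAx⟩ | ⟨hb, hc, hc3, hz1, hw, hAx⟩ | ⟨hb, hc, hz1, hw, hAx⟩ | ⟨hb, hc, hzc, hy1, hAx⟩ |
    ⟨hb, hc, hc3, hzm, hy1, hAx⟩ | ⟨hb1, hc, hcb, hzm, hy1, hw, hAx⟩ | ⟨hb1, hc, hzm, hy1, hw, hAx⟩ | ⟨hb1, hc, hcb, hzm, hy1, hAx⟩ |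
    ⟨m, hmb, hc, hp, hzm, hy1, hAx⟩ <;>
  obtain ⟨e0, e1, e2⟩ := vec3_eq (hasAxis_unique hϖ ha hAx)
  · omega
  · omega
  · omega
  · omega
  · omega
  · subst b
    refine ⟨by omega, by omega, by omega, by omega, ?_, hy1, hxb⟩
    rw [show c - 0 - 1 = c - 1 from by omega]; exact hzm
  · omega
  · omega
  · exact ⟨by omega, by omega, by omega, by omega, hzm, hy1, hxb⟩
  · omega

/-- **GLUED AXIS, ORIENTATION G₃: `a = (2ρ+1+s, 2ρ+1+s, 2ρ+1)`, `s ≥ 1` ⟹** `b = ρ + s`, `c = 2ρ+1`, `s` even `≥ 2`, `|z| = |ϖ^ρ|`, (`ρ ≥ 1 → |y| = 1`), `|x| = 1`.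
[cite: Kottwitz1986BaseChangeUnits, §1 pp. 240–241] [cite: Serre1980Trees, II §1.1] [cite: BruhatTits1972, §10] -/
theorem letters_of_hasAxis_G3 {σ : K →+* K} (hvσ : ∀ a, Valued.v (σ a) = Valued.v a)
    (hfix : ∀ t : K, σ t = t → t ≠ 0 → ∃ n : ℤ, Valued.v t = WithZero.exp (2 * n))
    {ϖ : K} (hϖ : Valued.v ϖ = WithZero.exp (-1 : ℤ)) (b c : ℕ) {x y z : K}
    (hx : Valued.v x ≤ 1) (hy : Valued.v y ≤ 1) (hz : Valued.v z ≤ 1)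
    (hn : IsNormalisedLattice (latt (Matrix.of ![![1, 0, 0], ![x, ϖ ^ b, 0], ![y, z, ϖ ^ c]])))
    (hpol : ∃ D : Fin 3 → K, (∀ i, σ (D i) = D i ∧ D i ≠ 0) ∧ IsVertexLattice σ ϖ (Matrix.diagonal D) 2 (latt (Matrix.of ![![1, 0, 0], ![x, ϖ ^ b, 0], ![y, z, ϖ ^ c]])))
    {ρ s : ℕ} (hs : 1 ≤ s) (ha : HasAxis ϖ (latt (Matrix.of ![![1, 0, 0], ![x, ϖ ^ b, 0], ![y, z, ϖ ^ c]])) ![2 * ρ + 1 + s, 2 * ρ + 1 + s, 2 * ρ + 1]) :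
    b = ρ + s ∧ c = 2 * ρ + 1 ∧ s % 2 = 0 ∧ 2 ≤ s ∧ Valued.v z = Valued.v (ϖ ^ ρ) ∧ (1 ≤ ρ → Valued.v y = 1) ∧ Valued.v x = 1 := by
  have hxb : 1 ≤ b → Valued.v x = 1 := v_x_eq_one_of_one_le hϖ hx hy hz hn
  rcases typeTwo_genuine hvσ hfix hϖ b c hx hy hz hn hpol with
    ⟨hc, hb, hAx⟩ | ⟨hb, hc, hz1, hw, hAx⟩ | ⟨hb, hc, hc3, hz1, hw, hAx⟩ | ⟨hb, hc, hz1, hw, hAx⟩ | ⟨hb, hc, hzc, hy1, hAx⟩ |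
    ⟨hb, hc, hc3, hzm, hy1, hAx⟩ | ⟨hb1, hc, hcb, hzm, hy1, hw, hAx⟩ | ⟨hb1, hc, hzm, hy1, hw, hAx⟩ | ⟨hb1, hc, hcb, hzm, hy1, hAx⟩ |
    ⟨m, hmb, hc, hp, hzm, hy1, hAx⟩ <;>
  obtain ⟨e0, e1, e2⟩ := vec3_eq (hasAxis_unique hϖ ha hAx)
  · omega
  · omega
  · omega
  · omega
  · omega
  · omega
  · omega
  · omega
  · omega
  · have hm : m = ρ := by omega
    subst hm
    exact ⟨by omega, by omega, by omega, by omega, hzm, hy1, hxb (by omega)⟩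

/-- **CORE-HANGING AXIS: `a = (2ρ+1, 2ρ+1, 2ρ+1)` ⟹** `b = ρ`, `c = 2ρ+1`, `|z| = |ϖ^b|`, `|xz − yϖ^b| = |ϖ^b|`, and `|y| = |x| = 1` once `b ≥ 1` (H(1) `ρ = 0` and H `ρ ≥ 1` in one text).
[cite: Kottwitz1986BaseChangeUnits, §1 pp. 240–241] [cite: Serre1980Trees, II §1.1] [cite: BruhatTits1972, §10] -/
theorem letters_of_hasAxis_H {σ : K →+* K} (hvσ : ∀ a, Valued.v (σ a) = Valued.v a)
    (hfix : ∀ t : K, σ t = t → t ≠ 0 → ∃ n : ℤ, Valued.v t = WithZero.exp (2 * n))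
    {ϖ : K} (hϖ : Valued.v ϖ = WithZero.exp (-1 : ℤ)) (b c : ℕ) {x y z : K}
    (hx : Valued.v x ≤ 1) (hy : Valued.v y ≤ 1) (hz : Valued.v z ≤ 1)
    (hn : IsNormalisedLattice (latt (Matrix.of ![![1, 0, 0], ![x, ϖ ^ b, 0], ![y, z, ϖ ^ c]])))
    (hpol : ∃ D : Fin 3 → K, (∀ i, σ (D i) = D i ∧ D i ≠ 0) ∧ IsVertexLattice σ ϖ (Matrix.diagonal D) 2 (latt (Matrix.of ![![1, 0, 0], ![x, ϖ ^ b, 0], ![y, z, ϖ ^ c]])))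
    {ρ : ℕ} (ha : HasAxis ϖ (latt (Matrix.of ![![1, 0, 0], ![x, ϖ ^ b, 0], ![y, z, ϖ ^ c]])) ![2 * ρ + 1, 2 * ρ + 1, 2 * ρ + 1]) :
    b = ρ ∧ c = 2 * ρ + 1 ∧ Valued.v z = Valued.v (ϖ ^ b) ∧ Valued.v (x * z - y * ϖ ^ b) = Valued.v (ϖ ^ b) ∧ (1 ≤ b → Valued.v y = 1) ∧ (1 ≤ b → Valued.v x = 1) := by
  have hxb : 1 ≤ b → Valued.v x = 1 := v_x_eq_one_of_one_le hϖ hx hy hz hn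
  rcases typeTwo_genuine hvσ hfix hϖ b c hx hy hz hn hpol with
    ⟨hc, hb, hAx⟩ | ⟨hb, hc, hz1, hw, hAx⟩ | ⟨hb, hc, hc3, hz1, hw, hAx⟩ | ⟨hb, hc, hz1, hw, hAx⟩ | ⟨hb, hc, hzc, hy1, hAx⟩ |
    ⟨hb, hc, hc3, hzm, hy1, hAx⟩ | ⟨hb1, hc, hcb, hzm, hy1, hw, hAx⟩ | ⟨hb1, hc, hzm, hy1, hw, hAx⟩ | ⟨hb1, hc, hcb, hzm, hy1, hAx⟩ |
    ⟨m, hmb, hc, hp, hzm, hy1, hAx⟩ <;>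
  obtain ⟨e0, e1, e2⟩ := vec3_eq (hasAxis_unique hϖ ha hAx)
  · omega
  · omega
  · omega
  · subst b; subst c
    exact ⟨by omega, by omega, by rw [pow_zero, map_one]; exact hz1, by rw [hw, pow_zero, map_one], fun h => absurd h (by omega), hxb⟩
  · omega
  · omega
  · omega
  · exact ⟨by omega, by omega, hzm, hw, fun _ => hy1, hxb⟩
  · omega
  · omega

/-- **ODD SPLIT AXIS T₁: `a = (0, s, s)` ⟹** `b = 0`, `c = s` odd, `|z| = 1`, `|xz − yϖ^b| ≤ |ϖ^c|`. [cite: Kottwitz1986BaseChangeUnits, §1 pp. 240–241] [cite: Serre1980Trees, II §1.1] -/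
theorem letters_of_hasAxis_T1 {σ : K →+* K} (hvσ : ∀ a, Valued.v (σ a) = Valued.v a)
    (hfix : ∀ t : K, σ t = t → t ≠ 0 → ∃ n : ℤ, Valued.v t = WithZero.exp (2 * n))
    {ϖ : K} (hϖ : Valued.v ϖ = WithZero.exp (-1 : ℤ)) (b c : ℕ) {x y z : K}
    (hx : Valued.v x ≤ 1) (hy : Valued.v y ≤ 1) (hz : Valued.v z ≤ 1)
    (hn : IsNormalisedLattice (latt (Matrix.of ![![1, 0, 0], ![x, ϖ ^ b, 0], ![y, z, ϖ ^ c]])))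
    (hpol : ∃ D : Fin 3 → K, (∀ i, σ (D i) = D i ∧ D i ≠ 0) ∧ IsVertexLattice σ ϖ (Matrix.diagonal D) 2 (latt (Matrix.of ![![1, 0, 0], ![x, ϖ ^ b, 0], ![y, z, ϖ ^ c]])))
    {s : ℕ} (ha : HasAxis ϖ (latt (Matrix.of ![![1, 0, 0], ![x, ϖ ^ b, 0], ![y, z, ϖ ^ c]])) ![0, s, s]) :
    b = 0 ∧ c = s ∧ s % 2 = 1 ∧ Valued.v z = 1 ∧ Valued.v (x * z - y * ϖ ^ b) ≤ Valued.v (ϖ ^ c) := by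
  rcases typeTwo_genuine hvσ hfix hϖ b c hx hy hz hn hpol with
    ⟨hc, hb, hAx⟩ | ⟨hb, hc, hz1, hw, hAx⟩ | ⟨hb, hc, hc3, hz1, hw, hAx⟩ | ⟨hb, hc, hz1, hw, hAx⟩ | ⟨hb, hc, hzc, hy1, hAx⟩ |
    ⟨hb, hc, hc3, hzm, hy1, hAx⟩ | ⟨hb1, hc, hcb, hzm, hy1, hw, hAx⟩ | ⟨hb1, hc, hzm, hy1, hw, hAx⟩ | ⟨hb1, hc, hcb, hzm, hy1, hAx⟩ |
    ⟨m, hmb, hc, hp, hzm, hy1, hAx⟩ <;>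
  obtain ⟨e0, e1, e2⟩ := vec3_eq (hasAxis_unique hϖ ha hAx)
  · omega
  · exact ⟨hb, by omega, by omega, hz1, hw⟩
  · omega
  · omega
  · omega
  · omega
  · omega
  · omega
  · omega
  · omega

/-- **ODD SPLIT AXIS T₂: `a = (s, 0, s)` ⟹** `b = 0`, `c = s` odd, `|z| ≤ |ϖ^c|`, `|y| = 1`. [cite: Kottwitz1986BaseChangeUnits, §1 pp. 240–241] [cite: Serre1980Trees, II §1.1] -/
theorem letters_of_hasAxis_T2 {σ : K →+* K} (hvσ : ∀ a, Valued.v (σ a) = Valued.v a)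
    (hfix : ∀ t : K, σ t = t → t ≠ 0 → ∃ n : ℤ, Valued.v t = WithZero.exp (2 * n))
    {ϖ : K} (hϖ : Valued.v ϖ = WithZero.exp (-1 : ℤ)) (b c : ℕ) {x y z : K}
    (hx : Valued.v x ≤ 1) (hy : Valued.v y ≤ 1) (hz : Valued.v z ≤ 1)
    (hn : IsNormalisedLattice (latt (Matrix.of ![![1, 0, 0], ![x, ϖ ^ b, 0], ![y, z, ϖ ^ c]])))
    (hpol : ∃ D : Fin 3 → K, (∀ i, σ (D i) = D i ∧ D i ≠ 0) ∧ IsVertexLattice σ ϖ (Matrix.diagonal D) 2 (latt (Matrix.of ![![1, 0, 0], ![x, ϖ ^ b, 0], ![y, z, ϖ ^ c]])))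
    {s : ℕ} (ha : HasAxis ϖ (latt (Matrix.of ![![1, 0, 0], ![x, ϖ ^ b, 0], ![y, z, ϖ ^ c]])) ![s, 0, s]) :
    b = 0 ∧ c = s ∧ s % 2 = 1 ∧ Valued.v z ≤ Valued.v (ϖ ^ c) ∧ Valued.v y = 1 := by
  rcases typeTwo_genuine hvσ hfix hϖ b c hx hy hz hn hpol with
    ⟨hc, hb, hAx⟩ | ⟨hb, hc, hz1, hw, hAx⟩ | ⟨hb, hc, hc3, hz1, hw, hAx⟩ | ⟨hb, hc, hz1, hw, hAx⟩ | ⟨hb, hc, hzc, hy1, hAx⟩ |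
    ⟨hb, hc, hc3, hzm, hy1, hAx⟩ | ⟨hb1, hc, hcb, hzm, hy1, hw, hAx⟩ | ⟨hb1, hc, hzm, hy1, hw, hAx⟩ | ⟨hb1, hc, hcb, hzm, hy1, hAx⟩ |
    ⟨m, hmb, hc, hp, hzm, hy1, hAx⟩ <;>
  obtain ⟨e0, e1, e2⟩ := vec3_eq (hasAxis_unique hϖ ha hAx)
  · omega
  · omega
  · omega
  · omega
  · exact ⟨hb, by omega, by omega, hzc, hy1⟩
  · omega
  · omega
  · omega
  · omega
  · omega

/-- **ODD SPLIT AXIS T₃: `a = (s, s, 0)` ⟹** `c = 0`, `b = s` odd, `|x| = 1`. [cite: Kottwitz1986BaseChangeUnits, §1 pp. 240–241] [cite: Serre1980Trees, II §1.1] -/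
theorem letters_of_hasAxis_T3 {σ : K →+* K} (hvσ : ∀ a, Valued.v (σ a) = Valued.v a)
    (hfix : ∀ t : K, σ t = t → t ≠ 0 → ∃ n : ℤ, Valued.v t = WithZero.exp (2 * n))
    {ϖ : K} (hϖ : Valued.v ϖ = WithZero.exp (-1 : ℤ)) (b c : ℕ) {x y z : K}
    (hx : Valued.v x ≤ 1) (hy : Valued.v y ≤ 1) (hz : Valued.v z ≤ 1)
    (hn : IsNormalisedLattice (latt (Matrix.of ![![1, 0, 0], ![x, ϖ ^ b, 0], ![y, z, ϖ ^ c]])))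
    (hpol : ∃ D : Fin 3 → K, (∀ i, σ (D i) = D i ∧ D i ≠ 0) ∧ IsVertexLattice σ ϖ (Matrix.diagonal D) 2 (latt (Matrix.of ![![1, 0, 0], ![x, ϖ ^ b, 0], ![y, z, ϖ ^ c]])))
    {s : ℕ} (ha : HasAxis ϖ (latt (Matrix.of ![![1, 0, 0], ![x, ϖ ^ b, 0], ![y, z, ϖ ^ c]])) ![s, s, 0]) :
    c = 0 ∧ b = s ∧ s % 2 = 1 ∧ Valued.v x = 1 := by
  have hxb : 1 ≤ b → Valued.v x = 1 := v_x_eq_one_of_one_le hϖ hx hy hz hn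
  rcases typeTwo_genuine hvσ hfix hϖ b c hx hy hz hn hpol with
    ⟨hc, hb, hAx⟩ | ⟨hb, hc, hz1, hw, hAx⟩ | ⟨hb, hc, hc3, hz1, hw, hAx⟩ | ⟨hb, hc, hz1, hw, hAx⟩ | ⟨hb, hc, hzc, hy1, hAx⟩ |
    ⟨hb, hc, hc3, hzm, hy1, hAx⟩ | ⟨hb1, hc, hcb, hzm, hy1, hw, hAx⟩ | ⟨hb1, hc, hzm, hy1, hw, hAx⟩ | ⟨hb1, hc, hcb, hzm, hy1, hAx⟩ |
    ⟨m, hmb, hc, hp, hzm, hy1, hAx⟩ <;>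
  obtain ⟨e0, e1, e2⟩ := vec3_eq (hasAxis_unique hϖ ha hAx)
  · exact ⟨hc, by omega, by omega, hxb (by omega)⟩
  · omega
  · omega
  · omega
  · omega
  · omega
  · omega
  · omega
  · omega
  · omega

end Summit.HodgeConjecture.HodgeConjecture.Cruxes.H413.F0P3cDyRamDiagonalTypeTwoGenuineCases

end
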